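import Summits.HodgeConjecture.HodgeConjecture.Theses.GenericDivisibility
import Literature.AlgebraicGeometry.Motives.UnramifiedCohomology
import Literature.AlgebraicTopology.SingularHomology.IntegralClassRingChange
import HarnessLib

/-!
# Route GenericDivisibility — crux `HodgeClassesGenericallyDivisible` (stmt-HodgeConjecture-18466), line `Sketch`: stub `stub_modularConiveau_of_divisible`

Registered stub 6 of the lead's skeleton `Cruxes/HodgeClassesGenericallyDivisible/Lines/Sketch.lean`
(the converse of the line's reduction): on an irreducible `ℂ`-scheme `X`, an integral class
`z ∈ H^q(X(ℂ); ℤ)` that is divisible by `m` on the complex points of a non-empty Zariski open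
`X ∖ Z` (`Z` closed, `Z ≠ X`) has reduction modulo `m` of coniveau `≥ 1`:
`z ⊗ ℤ/m ∈ N¹ H^q(X(ℂ); ℤ/m) = coniveauFiltration (ZMod m) X q 1`.

Proof: a proper closed subset of an irreducible scheme consists of points of codimension `≥ 1`
(`forall_one_le_coheight_iff_ne_univ`); change of coefficients commutes with restriction
(`singularCohomology.ringChange_map`), so `(z ⊗ ℤ/m)|_{(X∖Z)(ℂ)} = (m • y) ⊗ ℤ/m = m • (y ⊗ ℤ/m) = 0`
because `m = 0` in `ℤ/m`. References: Bloch–Ogus (1974) (3.8); Colliot-Thélène–Voisin (2012) §3.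
-/

noncomputable section

-- every declaration of this problem lives in `Summit.HodgeConjecture.HodgeConjecture.…` (summit = sub-problem)
set_option linter.dupNamespace false

open CategoryTheory AlgebraicGeometry
open Literature.AlgebraicGeometry.Motives Literature.AlgebraicGeometry.HodgeTheory
  Literature.AlgebraicTopology.SingularHomology

namespace Summit.HodgeConjecture.HodgeConjecture.Theorems

/-- Change of coefficients `ℤ → ℤ/m` commutes with restriction to the complex points over the
complement of `Z ⊆ X`: `(z ⊗ ℤ/m)|_{(X∖Z)(ℂ)} = (z|_{(X∖Z)(ℂ)}) ⊗ ℤ/m`. [cite: HatcherAT2002, §3.1 p. 198] -/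
theorem genericDivisibility_restrictToCompl_ringChange_zmod {X : SchemeOver ℂ} (q m : ℕ)
    (Z : Set X.left) (z : singularCohomology ℤ ℤ (ComplexPoints X) q) :
    restrictToCompl (ZMod m) X q Z
        (singularCohomology.ringChange (Int.castRingHom (ZMod m)) (ComplexPoints X) q z) =
      singularCohomology.ringChange (Int.castRingHom (ZMod m)) (complexPointsCompl X Z) q
        (restrictToCompl ℤ X q Z z) := by
  change singularCohomology.map (ZMod m) (ZMod m) _ q _ =
    singularCohomology.ringChange _ _ q (singularCohomology.map ℤ ℤ _ q z)
  rw [singularCohomology.ringChange_map]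

/-- **Stub 6 of line `Sketch` (crux C1): divisible by `m` on a non-empty Zariski open ⟹ the
mod-`m` reduction has coniveau `≥ 1`.** On an irreducible `ℂ`-scheme, if `z|_{(X∖Z)(ℂ)} = m • y`
for a closed `Z ≠ X`, then `z ⊗ ℤ/m ∈ N¹ H^q(X(ℂ); ℤ/m)`: every point of `Z` has codimension
`≥ 1`, and `(z ⊗ ℤ/m)|_{(X∖Z)(ℂ)} = m • (y ⊗ ℤ/m) = 0`. [cite: BlochOgus1974ENS, (3.8)] -/
theorem stub_modularConiveau_of_divisible : ∀ ⦃X : SchemeOver ℂ⦄ [IrreducibleSpace X.left] (q m : ℕ)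
    (z : singularCohomology ℤ ℤ (ComplexPoints X) q),
    (∃ Z : Set X.left, IsClosed Z ∧ Z ≠ Set.univ ∧
      ∃ y : singularCohomology ℤ ℤ (complexPointsCompl X Z) q, m • y = restrictToCompl ℤ X q Z z) →
    singularCohomology.ringChange (Int.castRingHom (ZMod m)) (ComplexPoints X) q z ∈
      coniveauFiltration (ZMod m) X q 1 := by
  intro X _ q m z h
  obtain ⟨Z, hZ, hZu, y, hy⟩ := h
  refine mem_coniveauFiltration_of_restrictToCompl_eq_zero (ZMod m) q hZ
    ((forall_one_le_coheight_iff_ne_univ hZ).2 hZu) ?_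
  rw [genericDivisibility_restrictToCompl_ringChange_zmod, ← hy, map_nsmul,
    ← Nat.cast_smul_eq_nsmul (ZMod m), ZMod.natCast_self, zero_smul]

end Summit.HodgeConjecture.HodgeConjecture.Theorems

end
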